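import Mathlib
import HarnessLib
import Literature.MathematicalPhysics.StatisticalMechanics.LinearisedMapBlockPartABKM
import Literature.MathematicalPhysics.StatisticalMechanics.RenormalisationMapBlockTermsQ
import Literature.MathematicalPhysics.StatisticalMechanics.LinearisedMapABKMContractionQ
import Literature.MathematicalPhysics.StatisticalMechanics.RenormalisationMapP2FluctQ

/-!
# The block part `C^{(q)}K − large part` of the linearised map and the smoothness of its summands for step
# data with a kernel BY PREDICATE ([ABKM19] Lemmas 10.1–10.2 / Ch. 9.1, `q ∈ B_κ`)

`RenormalisationMapSummandsSmooth` and `LinearisedMapBlockPartABKM` are stated for the step kernel EQUAL to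
the weight kernel `𝒞_{k+1}` (`q = 0`).  Of the kernel their proofs use only the facts recorded in
`StepKernelBounds` (`StepKernelBoundsABKM`).  This file is their `q`-twin for step data / kernels with
`StepKernelBounds W L k A𝒫' C₂ ·` relative to the `q = 0` weights (constant `A_𝒫 ↦ A𝒫'`):

* `contDiff_reblockTop_abkm_of_stepKernelBounds`, `contDiff_reblockSub_abkm_of_stepKernelBounds`,
  `contDiff_blockSummand_abkm_of_stepKernelBounds`, `contDiff_blockPart_abkm_of_stepKernelBounds`;
* **`weakNormLE_opC_abkm_conn_of_stepKernelBounds`**, `contDiff_largePart_abkm_of_stepKernelBounds`,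
  `blockPart_sub_abkm_of_stepKernelBounds`, **`tayNormLE_blockPart_abkm_of_stepKernelBounds`**,
  **`tayNormLE_blockPart_sub_abkm_of_stepKernelBounds`**.

The `q = 0` statements are recovered with `AbkmWeightBounds.stepKernelBounds`.  Everything is proved;
no named fact.

## References
* S. Adams, S. Buchholz, R. Kotecký, S. Müller, arXiv:1910.13564, Theorem 6.8, Ch. 9.1, Lemmas 10.1–10.6,
  Lemma 7.7, Lemma 8.4 [AdamsBuchholzKoteckyMuller2019].
-/

noncomputable section

namespace Literature.MathematicalPhysics.StatisticalMechanics.GradientRG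

open scoped BigOperators Classical
open Finset MeasureTheory
open Literature.MathematicalPhysics.StatisticalMechanics.TorusPolymer
  (IsPolymer blocks polys bprod blockOf thicken reblock boxCorner translate IsLatticeVec mem_polys mem_blocks
    numBlocks isPolymer_blockOf card_blocks_eq_numBlocks isPolymer_translate isConn_translate translate_translate
    translate_zero blocks_blockOf empty_mem_polys sum_rest_blockOf_eq_zero)
open Literature.Barriers.CriticalPhenomena.LongRangePhi4.Polymer (IsConn components)
open Literature.MathematicalPhysics.QuantumFieldTheory

variable {d M : ℕ} [NeZero M]

/-- **The summand of `Σ₂ᴸ` / `Σ₃` is `C^{r₀}`**: `φ ↦ p_X(φ)·(R[P₂(X)](φ) + (1−e^{−H̃})^X(φ))` for a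
`k`-polymer `X` and the torus data. [cite: AdamsBuchholzKoteckyMuller2019, Lemma 9.6 / Lemma 8.4] -/
theorem contDiff_reblockTop_abkm_of_stepKernelBounds {L N Mord R n p r₀ : ℕ} {θbar lam μ δ₁ δ₀ A𝒫 A𝒫' C₂ h A : ℝ}
    {𝒞 : ℕ → (Fin d → ZMod M) → ℝ} (hd : 2 ≤ d) (hLodd : Odd L)
    (hM : M = L ^ N) {k : ℕ} (hkN : k + 1 ≤ N)
    {𝒞q : (Fin d → ZMod M) → ℝ} (hS : StepKernelBounds (abkmWeightData L N Mord R θbar (schedDelta δ₀ δ₁ N) 𝒞) L k A𝒫' C₂ 𝒞q) (hp : d / 2 + 1 ≤ p) (hMord : d / 2 + 1 ≤ Mord)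
   
    (hB : AbkmWeightBounds L N Mord R n θbar lam μ δ₁ δ₀ A𝒫 𝒞
      (abkmWeightData L N Mord R θbar (schedDelta δ₀ δ₁ N) 𝒞))
    (hδ₀ : 0 < δ₀) (hδ₁ : 0 < δ₁) (hh : 0 < h) (hh0 : hZeroSq d R δ₀ δ₁ ≤ h ^ 2) (hA : 0 < A)
    {X : Finset (Fin d → ZMod M)} (hX : IsPolymer (L ^ k) X) (Ht : RelevantHamiltonian ℂ d)
    {H : RelevantHamiltonian ℂ d}
    (hH : hamNorm (fieldWt h (L : ℝ) d k) ((L : ℝ) ^ k) (L ^ (d * k)) H ≤ 1 / 8)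
    {K : Finset (Fin d → ZMod M) → ((Fin d → ZMod M) → ℝ) → ℂ} {C : ℝ} (hC : 0 ≤ C)
    (hK : WeakNormLE (abkmNormParams L N Mord R p r₀ h θbar A (schedDelta δ₀ δ₁ N) 𝒞) k K C)
    (hKfac : Factorises (L ^ k) K) (hK0 : ∀ φ, K ∅ φ = 1) (hKd : ∀ Y, ContDiff ℝ r₀ (K Y))
    (hKloc : ∀ Y, IsPolymer (L ^ k) Y → IsConn Y →
      IsGaugeLocal ((abkmNormParams L N Mord R p r₀ h θbar A (schedDelta δ₀ δ₁ N) 𝒞).gauge k Y) (K Y))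
    (U : Finset (Fin d → ZMod M)) :
    ContDiff ℝ r₀ (fun φ : (Fin d → ZMod M) → ℝ =>
      bprod (L ^ k) (fun B => expNegH Ht B φ) (U \ X) * bprod (L ^ k) (fun B => expNegH (-Ht) B φ) (X \ U) *
        (fluct 𝒞q (polyP2 (L ^ k) H K X) φ + bprod (L ^ k) (fun B => 1 - expNegH Ht B φ) X)) := by
  have hR := contDiff_fluct_polyP2_abkm_of_stepKernelBounds hd hLodd hM hkN hS hp hMord hB hδ₀ hδ₁ hh hh0 hA hX hH hC hK hKfac
    hK0 hKd hKloc
  exact ((contDiff_bprod_expNegH _ Ht _ r₀).mul (contDiff_bprod_expNegH _ (-Ht) _ r₀)).mul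
    (hR.add (contDiff_bprod_one_sub_expNegH _ Ht _ r₀))

/-- **The summand of `Σ₄` is `C^{r₀}`**: `φ ↦ p_X(φ)·((1−e^{−H̃})^{X₁}(φ)·R[P₂(X∖X₁)](φ))` for a `k`-polymer
`X`, `X₁ ∈ 𝓟_k(X)`, and the torus data. [cite: AdamsBuchholzKoteckyMuller2019, Lemma 9.6 / Lemma 8.4] -/
theorem contDiff_reblockSub_abkm_of_stepKernelBounds {L N Mord R n p r₀ : ℕ} {θbar lam μ δ₁ δ₀ A𝒫 A𝒫' C₂ h A : ℝ}
    {𝒞 : ℕ → (Fin d → ZMod M) → ℝ} (hd : 2 ≤ d) (hLodd : Odd L)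
    (hM : M = L ^ N) {k : ℕ} (hkN : k + 1 ≤ N)
    {𝒞q : (Fin d → ZMod M) → ℝ} (hS : StepKernelBounds (abkmWeightData L N Mord R θbar (schedDelta δ₀ δ₁ N) 𝒞) L k A𝒫' C₂ 𝒞q) (hp : d / 2 + 1 ≤ p) (hMord : d / 2 + 1 ≤ Mord)
   
    (hB : AbkmWeightBounds L N Mord R n θbar lam μ δ₁ δ₀ A𝒫 𝒞
      (abkmWeightData L N Mord R θbar (schedDelta δ₀ δ₁ N) 𝒞))
    (hδ₀ : 0 < δ₀) (hδ₁ : 0 < δ₁) (hh : 0 < h) (hh0 : hZeroSq d R δ₀ δ₁ ≤ h ^ 2) (hA : 0 < A)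
    {X : Finset (Fin d → ZMod M)} (hX : IsPolymer (L ^ k) X) {X₁ : Finset (Fin d → ZMod M)}
    (hX₁ : X₁ ∈ polys (L ^ k) X) (Ht : RelevantHamiltonian ℂ d)
    {H : RelevantHamiltonian ℂ d}
    (hH : hamNorm (fieldWt h (L : ℝ) d k) ((L : ℝ) ^ k) (L ^ (d * k)) H ≤ 1 / 8)
    {K : Finset (Fin d → ZMod M) → ((Fin d → ZMod M) → ℝ) → ℂ} {C : ℝ} (hC : 0 ≤ C)
    (hK : WeakNormLE (abkmNormParams L N Mord R p r₀ h θbar A (schedDelta δ₀ δ₁ N) 𝒞) k K C)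
    (hKfac : Factorises (L ^ k) K) (hK0 : ∀ φ, K ∅ φ = 1) (hKd : ∀ Y, ContDiff ℝ r₀ (K Y))
    (hKloc : ∀ Y, IsPolymer (L ^ k) Y → IsConn Y →
      IsGaugeLocal ((abkmNormParams L N Mord R p r₀ h θbar A (schedDelta δ₀ δ₁ N) 𝒞).gauge k Y) (K Y))
    (U : Finset (Fin d → ZMod M)) :
    ContDiff ℝ r₀ (fun φ : (Fin d → ZMod M) → ℝ =>
      bprod (L ^ k) (fun B => expNegH Ht B φ) (U \ X) * bprod (L ^ k) (fun B => expNegH (-Ht) B φ) (X \ U) *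
        (bprod (L ^ k) (fun B => 1 - expNegH Ht B φ) X₁ * fluct 𝒞q (polyP2 (L ^ k) H K (X \ X₁)) φ)) := by
  have hXp : IsPolymer (L ^ k) (X \ X₁) := hX.sdiff (mem_polys.1 hX₁).2
  have hR := contDiff_fluct_polyP2_abkm_of_stepKernelBounds hd hLodd hM hkN hS hp hMord hB hδ₀ hδ₁ hh hh0 hA hXp hH hC hK hKfac
    hK0 hKd hKloc
  exact ((contDiff_bprod_expNegH _ Ht _ r₀).mul (contDiff_bprod_expNegH _ (-Ht) _ r₀)).mul
    ((contDiff_bprod_one_sub_expNegH _ Ht _ r₀).mul hR)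

/-- **The summand of `Σ₁` is `C^{r₀}`** on a block `B = B_y` (torus data; the `rest(B)` term is the
fluctuation integral of `0`). [cite: AdamsBuchholzKoteckyMuller2019, Theorem 6.8 / Lemma 8.4] -/
theorem contDiff_blockSummand_abkm_of_stepKernelBounds {L N Mord R n p r₀ : ℕ} {θbar lam μ δ₁ δ₀ A𝒫 A𝒫' C₂ h A : ℝ}
    {𝒞 : ℕ → (Fin d → ZMod M) → ℝ} (hd : 2 ≤ d)
    (hB : AbkmWeightBounds L N Mord R n θbar lam μ δ₁ δ₀ A𝒫 𝒞
      (abkmWeightData L N Mord R θbar (schedDelta δ₀ δ₁ N) 𝒞))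
    (hLodd : Odd L) (hM : M = L ^ N) {k : ℕ} (hkN : k + 1 ≤ N) (hδ₀ : 0 < δ₀) (hδ₁ : 0 < δ₁) (hh : 0 < h)
    (hh0 : hZeroSq d R δ₀ δ₁ ≤ h ^ 2) (hMord : d / 2 + 1 ≤ Mord) (hp : d / 2 + 1 ≤ p) (hA : 0 < A)
    (D : StepData d M) (hS : StepKernelBounds (abkmWeightData L N Mord R θbar (schedDelta δ₀ δ₁ N) 𝒞) L k A𝒫' C₂ D.𝒞) (y : Fin d → ZMod M) (Ht : RelevantHamiltonian ℂ d)
    {H : RelevantHamiltonian ℂ d}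
    (hH : hamNorm (fieldWt h (L : ℝ) d k) ((L : ℝ) ^ k) (L ^ (d * k)) H ≤ 1 / 8)
    {K : Finset (Fin d → ZMod M) → ((Fin d → ZMod M) → ℝ) → ℂ} {C : ℝ} (hC : 0 ≤ C)
    (hK : WeakNormLE (abkmNormParams L N Mord R p r₀ h θbar A (schedDelta δ₀ δ₁ N) 𝒞) k K C)
    (hKd : ∀ Y, ContDiff ℝ r₀ (K Y))
    (hKloc : ∀ Y, IsPolymer (L ^ k) Y → IsConn Y →
      IsGaugeLocal ((abkmNormParams L N Mord R p r₀ h θbar A (schedDelta δ₀ δ₁ N) 𝒞).gauge k Y) (K Y))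
    (U : Finset (Fin d → ZMod M)) :
    ContDiff ℝ r₀ (fun φ : (Fin d → ZMod M) → ℝ =>
      (bprod (L ^ k) (fun B' => expNegH Ht B' φ) (U \ blockOf (L ^ k) y) *
            bprod (L ^ k) (fun B' => expNegH (-Ht) B' φ) (blockOf (L ^ k) y \ U) - 1) * blockTerm D K (blockOf (L ^ k) y) φ +
        bprod (L ^ k) (fun B' => expNegH Ht B' φ) (U \ blockOf (L ^ k) y) *
            bprod (L ^ k) (fun B' => expNegH (-Ht) B' φ) (blockOf (L ^ k) y \ U) *
          (fluctDefect D.𝒞 H (blockOf (L ^ k) y) φ +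
            (expNegH (stepOpA (gradCov D.𝒞) H) (blockOf (L ^ k) y) φ - 1) *
              (1 - Complex.exp (-(eval (opB D K) (blockOf (L ^ k) y) φ))) -
            (Complex.exp (-(eval (opB D K) (blockOf (L ^ k) y) φ)) - 1 + eval (opB D K) (blockOf (L ^ k) y) φ)) +
        bprod (L ^ k) (fun B' => expNegH Ht B' φ) (U \ blockOf (L ^ k) y) *
            bprod (L ^ k) (fun B' => expNegH (-Ht) B' φ) (blockOf (L ^ k) y \ U) *
          fluct D.𝒞 (fun ψ => ∑ Y ∈ ((polys (L ^ k) (blockOf (L ^ k) y)).erase (blockOf (L ^ k) y)).erase ∅,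
            bprod (L ^ k) (fun B' => expNegH H B' ψ - 1) (blockOf (L ^ k) y \ Y) * K Y ψ) φ) := by
  have hk1 : k + 1 ≤ N + 1 := by omega
  have hk : k ≤ N := by omega
  have hG := contDiff_blockTerm_abkm_of_stepKernelBounds hB hLodd hM hA D hS y hC hK hKd hKloc
  have hΦ := contDiff_blockBracket_abkm_of_stepKernelBounds (p := p) (r₀ := r₀) (A := A) hd hB hLodd hM hk hS hδ₀ hδ₁ hh hh0 hMord
    hp y (opB D K) hH
  have hrest : (fun ψ : (Fin d → ZMod M) → ℝ =>
      ∑ Y ∈ ((polys (L ^ k) (blockOf (L ^ k) y)).erase (blockOf (L ^ k) y)).erase ∅,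
        bprod (L ^ k) (fun B' => expNegH H B' ψ - 1) (blockOf (L ^ k) y \ Y) * K Y ψ) = fun _ => (0 : ℂ) := by
    funext ψ; exact sum_rest_blockOf_eq_zero _ _ _
  have hR : ContDiff ℝ r₀ (fluct D.𝒞 (fun ψ : (Fin d → ZMod M) → ℝ =>
      ∑ Y ∈ ((polys (L ^ k) (blockOf (L ^ k) y)).erase (blockOf (L ^ k) y)).erase ∅,
        bprod (L ^ k) (fun B' => expNegH H B' ψ - 1) (blockOf (L ^ k) y \ Y) * K Y ψ)) := by
    rw [hrest, fluct_const]; exact contDiff_const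
  have hpB := (contDiff_bprod_expNegH (L ^ k) Ht (U \ blockOf (L ^ k) y) r₀).mul
    (contDiff_bprod_expNegH (L ^ k) (-Ht) (blockOf (L ^ k) y \ U) r₀)
  exact (((hpB.sub contDiff_const).mul hG).add (hpB.mul hΦ)).add (hpB.mul hR)

/-- **`blockPart D K U` is `C^{r₀}`** for the torus data (`D.s = L^k`).
[cite: AdamsBuchholzKoteckyMuller2019, Ch. 10.1 (10.3) / Lemma 8.4] -/
theorem contDiff_blockPart_abkm_of_stepKernelBounds {L N Mord R n p r₀ : ℕ} {θbar lam μ δ₁ δ₀ A𝒫 A𝒫' C₂ h A : ℝ}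
    {𝒞 : ℕ → (Fin d → ZMod M) → ℝ}
    (hB : AbkmWeightBounds L N Mord R n θbar lam μ δ₁ δ₀ A𝒫 𝒞
      (abkmWeightData L N Mord R θbar (schedDelta δ₀ δ₁ N) 𝒞))
    (hLodd : Odd L) (hM : M = L ^ N) {k : ℕ} (hA : 0 < A)
    (D : StepData d M) (hDs : D.s = L ^ k) (hS : StepKernelBounds (abkmWeightData L N Mord R θbar (schedDelta δ₀ δ₁ N) 𝒞) L k A𝒫' C₂ D.𝒞)
    {K : Finset (Fin d → ZMod M) → ((Fin d → ZMod M) → ℝ) → ℂ} {C : ℝ} (hC : 0 ≤ C)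
    (hK : WeakNormLE (abkmNormParams L N Mord R p r₀ h θbar A (schedDelta δ₀ δ₁ N) 𝒞) k K C)
    (hKd : ∀ X, ContDiff ℝ r₀ (K X))
    (hKloc : ∀ X, IsPolymer (L ^ k) X → IsConn X →
      IsGaugeLocal ((abkmNormParams L N Mord R p r₀ h θbar A (schedDelta δ₀ δ₁ N) 𝒞).gauge k X) (K X))
    (U : Finset (Fin d → ZMod M)) :
    ContDiff ℝ r₀ (blockPart D K U) := by
  have hfun : blockPart D K U = fun φ => ∑ B ∈ blockPartIndex D U, blockTerm D K B φ := by
    funext φ; rfl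
  rw [hfun]
  refine ContDiff.sum fun B hB' => ?_
  have hBb := blockPartIndex_subset_blocks D U hB'
  rw [hDs] at hBb
  obtain ⟨y, -, rfl⟩ := mem_blocks.1 hBb
  exact contDiff_blockTerm_abkm_of_stepKernelBounds hB hLodd hM hA D hS y hC hK hKd hKloc

/-- **[ABKM19] Lemma 10.1 for the torus data, closure gain discharged, no global smoothness hypothesis on
`R_{k+1}K`**: the statement of `weakNormLE_opC_abkm_gain_of_stepKernelBounds` without `hRd` (the linearised map only reads `K`
on connected `k`-polymers, where `R_{k+1}K(X)` is `C^{r₀}` by `contDiff_fluct_of_weakNormLE`).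
[cite: AdamsBuchholzKoteckyMuller2019, Lemma 10.1] -/
theorem weakNormLE_opC_abkm_conn_of_stepKernelBounds {L N Mord R n p r₀ : ℕ} {θbar lam μ δ₁ δ₀ A𝒫 A𝒫' C₂ h A : ℝ}
    {𝒞 : ℕ → (Fin d → ZMod M) → ℝ} (hd : 3 ≤ d) (hLodd : Odd L) (hL : 2 ^ (d + 3) + 16 * R ≤ L)
    (hM : M = L ^ N) {k : ℕ} (hkN : k + 1 ≤ N) (hp : d / 2 + 2 ≤ p) (hpM : p + d ≤ Mord)
    (hMR : Mord ≤ R) (hr₀ : 3 ≤ r₀)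
    (hB : AbkmWeightBounds L N Mord R n θbar lam μ δ₁ δ₀ A𝒫 𝒞
      (abkmWeightData L N Mord R θbar (schedDelta δ₀ δ₁ N) 𝒞))
    (hδ₀ : 0 < δ₀) (hδ₁ : 0 < δ₁) (hh : 0 < h) (hh0 : hZeroSq d R δ₀ δ₁ ≤ h ^ 2)
    (hA𝒫 : 0 ≤ A𝒫') (hA : 1 ≤ A) (hA𝒫A : A𝒫' ≤ A)
    (hsmall : (2 : ℝ) ^ (L ^ d) * (A𝒫' * A ^ (-(1 - (1 + 1 / ((2 * (2 ^ d + 1) + 6 : ℝ) ^ d))⁻¹) : ℝ)) ≤ 1)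
    (D : StepData d M) (hDs : D.s = L ^ k) (hDL : D.L = L) (hS : StepKernelBounds (abkmWeightData L N Mord R θbar (schedDelta δ₀ δ₁ N) 𝒞) L k A𝒫' C₂ D.𝒞)
    {x₀ : Fin d → ZMod M} (hB₀ : D.B₀ = blockOf (L ^ k) x₀)
    (hc₀ : D.c₀ = boxCorner (L ^ k) (starRad R L d k) x₀)
    {K : Finset (Fin d → ZMod M) → ((Fin d → ZMod M) → ℝ) → ℂ} {C : ℝ} (hC : 0 ≤ C)
    (hK : WeakNormLE (abkmNormParams L N Mord R p r₀ h θbar A (schedDelta δ₀ δ₁ N) 𝒞) k K C)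
    (hKt : TransInv (L ^ k) K) (hKd : ∀ X, ContDiff ℝ r₀ (K X))
    (hKloc : ∀ X, IsPolymer (L ^ k) X → IsConn X →
      IsGaugeLocal ((abkmNormParams L N Mord R p r₀ h θbar A (schedDelta δ₀ δ₁ N) 𝒞).gauge k X) (K X)) :
    WeakNormLE (abkmNormParams L N Mord R p r₀ h θbar A (schedDelta δ₀ δ₁ N) 𝒞) (k + 1) (opC D K)
      (C * ((L : ℝ) ^ d * (A𝒫' * abkmContrConst d L R) +
        largePartEps d L A A𝒫' (1 + 1 / ((2 * (2 ^ d + 1) + 6 : ℝ) ^ d)))) := by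
  set P := abkmNormParams L N Mord R p r₀ h θbar A (schedDelta δ₀ δ₁ N) 𝒞 with hP
  have hA0 : 0 < A := by linarith
  have hk1 : k + 1 ≤ N + 1 := by omega
  have hMo : Odd M := by rw [hM]; exact hLodd.pow
  have hsodd : Odd (L ^ k) := hLodd.pow
  obtain ⟨t, ht⟩ : ∃ t, N = k + t := ⟨N - k, by omega⟩
  have hMt : M = L ^ k * L ^ t := by rw [← pow_add, ← ht]; exact hM
  have htodd : Odd (L ^ t) := hLodd.pow
  -- restrict `K` to connected `k`-polymers
  set K' : Finset (Fin d → ZMod M) → ((Fin d → ZMod M) → ℝ) → ℂ :=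
    fun X => if IsPolymer (L ^ k) X ∧ IsConn X then K X else 0 with hK'def
  have hK'eq : ∀ X, IsPolymer (L ^ k) X → IsConn X → K' X = K X := fun X hX hc => by
    show (if IsPolymer (L ^ k) X ∧ IsConn X then K X else 0) = K X
    exact if_pos ⟨hX, hc⟩
  have hK'ne : ∀ X, ¬ (IsPolymer (L ^ k) X ∧ IsConn X) → K' X = 0 := fun X hX => by
    show (if IsPolymer (L ^ k) X ∧ IsConn X then K X else 0) = 0
    exact if_neg hX
  have hK' : WeakNormLE P k K' C := fun X hX hc => by rw [hK'eq X hX hc]; exact hK X hX hc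
  have hK'd : ∀ X, ContDiff ℝ P.r₀ (K' X) := fun X => by
    by_cases hX : IsPolymer (L ^ k) X ∧ IsConn X
    · rw [hK'eq X hX.1 hX.2]; exact hKd X
    · rw [hK'ne X hX]; exact contDiff_const
  have hK'loc : ∀ X, IsPolymer (P.L ^ k) X → IsConn X → IsGaugeLocal (P.gauge k X) (K' X) :=
    fun X hX hc => by rw [hK'eq X hX hc]; exact hKloc X hX hc
  have hR'd : ∀ X, ContDiff ℝ P.r₀ (fluct D.𝒞 (K' X)) := fun X => by
    by_cases hX : IsPolymer (L ^ k) X ∧ IsConn X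
    · rw [hK'eq X hX.1 hX.2]
      exact contDiff_fluct_of_weakNormLE_of_stepKernelBounds hB hS hA0 hC hK hKd hKloc hX.1 hX.2
    · rw [hK'ne X hX]
      have h0 : fluct D.𝒞 (0 : ((Fin d → ZMod M) → ℝ) → ℂ) = fun _ => 0 := fluct_const _ 0
      rw [h0]; exact contDiff_const
  have hK't : TransInv (L ^ k) K' := by
    intro a ha X φ
    by_cases hX : IsPolymer (L ^ k) X ∧ IsConn X
    · have hX' : IsPolymer (L ^ k) (translate a X) ∧ IsConn (translate a X) :=
        ⟨isPolymer_translate hMt hsodd htodd ha hX.1, isConn_translate hX.2 a⟩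
      rw [hK'eq _ hX'.1 hX'.2, hK'eq X hX.1 hX.2]
      exact hKt a ha X φ
    · have hX' : ¬ (IsPolymer (L ^ k) (translate a X) ∧ IsConn (translate a X)) := by
        intro h'
        apply hX
        have e : translate (-a) (translate a X) = X := by rw [translate_translate, add_neg_cancel, translate_zero]
        exact ⟨e ▸ isPolymer_translate hMt hsodd htodd ha.neg h'.1, e ▸ isConn_translate h'.2 (-a)⟩
      rw [hK'ne _ hX', hK'ne X hX]
      rfl
  -- the linearised map only reads `K` on connected polymers
  have hB₀c : IsPolymer (L ^ k) D.B₀ ∧ IsConn D.B₀ := by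
    rw [hB₀]; exact ⟨isPolymer_blockOf _ x₀, TorusPolymer.isConn_blockOf hMo hsodd x₀⟩
  have hopB : opB D K' = opB D K := by
    unfold opB; rw [hK'eq D.B₀ hB₀c.1 hB₀c.2]
  have hopC : opC D K = opC D K' := by
    funext U φ
    show blockPart D K U φ + largePart D.s D.L (fluct D.𝒞) K U φ =
      blockPart D K' U φ + largePart D.s D.L (fluct D.𝒞) K' U φ
    congr 1
    · unfold blockPart
      refine sum_congr rfl fun B hB' => ?_
      have hBb := blockPartIndex_subset_blocks D U hB'
      rw [hDs] at hBb
      obtain ⟨y, -, rfl⟩ := mem_blocks.1 hBb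
      unfold blockTerm
      rw [hopB, hK'eq _ (isPolymer_blockOf _ y) (TorusPolymer.isConn_blockOf hMo hsodd y)]
    · unfold largePart
      rw [hDs, hDL]
      refine sum_congr rfl fun X hX => ?_
      obtain ⟨hXp, hXc, -, -⟩ := mem_largePartIndex.1 hX
      rw [hK'eq X hXp hXc]
  rw [hopC]
  exact weakNormLE_opC_abkm_gain_of_stepKernelBounds hd hLodd hL hM hkN hp hpM hMR hr₀ hB hδ₀ hδ₁ hh hh0 hA𝒫 hA hA𝒫A hsmall
    D hDs hDL hS hB₀ hc₀ hC hK' hK't hK'd hK'loc hR'd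

/-- **The large part is `C^{r₀}`** for the torus data (its index set consists of connected polymers).
[cite: AdamsBuchholzKoteckyMuller2019, Lemma 10.2 / Lemma 8.4] -/
theorem contDiff_largePart_abkm_of_stepKernelBounds {L N Mord R n p r₀ : ℕ} {θbar lam μ δ₁ δ₀ A𝒫 A𝒫' C₂ h A : ℝ}
    {𝒞 : ℕ → (Fin d → ZMod M) → ℝ}
    (hB : AbkmWeightBounds L N Mord R n θbar lam μ δ₁ δ₀ A𝒫 𝒞
      (abkmWeightData L N Mord R θbar (schedDelta δ₀ δ₁ N) 𝒞))
    {k : ℕ}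
    {𝒞q : (Fin d → ZMod M) → ℝ} (hS : StepKernelBounds (abkmWeightData L N Mord R θbar (schedDelta δ₀ δ₁ N) 𝒞) L k A𝒫' C₂ 𝒞q) (hA : 0 < A)
    {K : Finset (Fin d → ZMod M) → ((Fin d → ZMod M) → ℝ) → ℂ} {C : ℝ} (hC : 0 ≤ C)
    (hK : WeakNormLE (abkmNormParams L N Mord R p r₀ h θbar A (schedDelta δ₀ δ₁ N) 𝒞) k K C)
    (hKd : ∀ X, ContDiff ℝ r₀ (K X))
    (hKloc : ∀ X, IsPolymer (L ^ k) X → IsConn X →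
      IsGaugeLocal ((abkmNormParams L N Mord R p r₀ h θbar A (schedDelta δ₀ δ₁ N) 𝒞).gauge k X) (K X))
    (U : Finset (Fin d → ZMod M)) :
    ContDiff ℝ r₀ (largePart (L ^ k) L (fluct 𝒞q) K U) := by
  have hfun : largePart (L ^ k) L (fluct 𝒞q) K U =
      fun φ => ∑ X ∈ largePartIndex (L ^ k) L U, fluct 𝒞q (K X) φ := by
    funext φ; rfl
  rw [hfun]
  refine ContDiff.sum fun X hX => ?_
  obtain ⟨hXp, hXc, -, -⟩ := mem_largePartIndex.1 hX
  exact contDiff_fluct_of_weakNormLE_of_stepKernelBounds hB hS hA hC hK hKd hKloc hXp hXc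

/-- **`blockPart` is additive in `K`** (difference form, torus data):
`blockPart D K U − blockPart D K' U = blockPart D (K − K') U`.
[cite: AdamsBuchholzKoteckyMuller2019, Theorem 6.8 (C_k is linear) / Ch. 10.1 (10.3)] -/
theorem blockPart_sub_abkm_of_stepKernelBounds {L N Mord R n p r₀ : ℕ} {θbar lam μ δ₁ δ₀ A𝒫 A𝒫' C₂ h A : ℝ}
    {𝒞 : ℕ → (Fin d → ZMod M) → ℝ}
    (hB : AbkmWeightBounds L N Mord R n θbar lam μ δ₁ δ₀ A𝒫 𝒞
      (abkmWeightData L N Mord R θbar (schedDelta δ₀ δ₁ N) 𝒞))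
    {k : ℕ} (hr₀ : 2 ≤ r₀) (hLodd : Odd L) (hM : M = L ^ N) (hA : 0 < A)
    (D : StepData d M) (hDs : D.s = L ^ k) (hS : StepKernelBounds (abkmWeightData L N Mord R θbar (schedDelta δ₀ δ₁ N) 𝒞) L k A𝒫' C₂ D.𝒞) {x₀ : Fin d → ZMod M}
    (hB₀ : D.B₀ = blockOf (L ^ k) x₀)
    {K K' : Finset (Fin d → ZMod M) → ((Fin d → ZMod M) → ℝ) → ℂ} {C C' : ℝ} (hC : 0 ≤ C) (hC' : 0 ≤ C')
    (hK : WeakNormLE (abkmNormParams L N Mord R p r₀ h θbar A (schedDelta δ₀ δ₁ N) 𝒞) k K C)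
    (hK' : WeakNormLE (abkmNormParams L N Mord R p r₀ h θbar A (schedDelta δ₀ δ₁ N) 𝒞) k K' C')
    (hKd : ∀ X, ContDiff ℝ r₀ (K X)) (hK'd : ∀ X, ContDiff ℝ r₀ (K' X))
    (hKloc : ∀ X, IsPolymer (L ^ k) X → IsConn X →
      IsGaugeLocal ((abkmNormParams L N Mord R p r₀ h θbar A (schedDelta δ₀ δ₁ N) 𝒞).gauge k X) (K X))
    (hK'loc : ∀ X, IsPolymer (L ^ k) X → IsConn X →
      IsGaugeLocal ((abkmNormParams L N Mord R p r₀ h θbar A (schedDelta δ₀ δ₁ N) 𝒞).gauge k X) (K' X))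
    (U : Finset (Fin d → ZMod M)) :
    (fun φ => blockPart D K U φ - blockPart D K' U φ) = blockPart D (K - K') U := by
  funext φ
  show (∑ B ∈ blockPartIndex D U, blockTerm D K B φ) - ∑ B ∈ blockPartIndex D U, blockTerm D K' B φ =
    ∑ B ∈ blockPartIndex D U, blockTerm D (K - K') B φ
  rw [← sum_sub_distrib]
  refine sum_congr rfl fun B hB' => ?_
  have hBb := blockPartIndex_subset_blocks D U hB'
  rw [hDs] at hBb
  obtain ⟨y, -, rfl⟩ := mem_blocks.1 hBb
  have h := blockTerm_sub_abkm_of_stepKernelBounds hB hr₀ hLodd hM hA D hS hB₀ y hC hC' hK hK' hKd hK'd hKloc hK'loc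
  exact congrFun h φ

/-- **The block part of `C_kK` on a connected `(k+1)`-polymer** ([ABKM19] Lemma 10.1 + Lemma 10.2,
`blockPart = opC − largePart`): with the data of `weakNormLE_opC_abkm_conn_of_stepKernelBounds`,
`|blockPart D K U|_{T_{k+1}^{U*}, w_{k+1}^U} ≤ C(θ₀ + ε)A^{−|U|_{k+1}}`.
[cite: AdamsBuchholzKoteckyMuller2019, Lemma 10.1 / Lemma 10.2] -/
theorem tayNormLE_blockPart_abkm_of_stepKernelBounds {L N Mord R n p r₀ : ℕ} {θbar lam μ δ₁ δ₀ A𝒫 A𝒫' C₂ h A : ℝ}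
    {𝒞 : ℕ → (Fin d → ZMod M) → ℝ} (hd : 3 ≤ d) (hLodd : Odd L) (hL : 2 ^ (d + 3) + 16 * R ≤ L)
    (hM : M = L ^ N) {k : ℕ} (hkN : k + 1 ≤ N) (hp : d / 2 + 2 ≤ p) (hpM : p + d ≤ Mord)
    (hMR : Mord ≤ R) (hr₀ : 3 ≤ r₀)
    (hB : AbkmWeightBounds L N Mord R n θbar lam μ δ₁ δ₀ A𝒫 𝒞
      (abkmWeightData L N Mord R θbar (schedDelta δ₀ δ₁ N) 𝒞))
    (hδ₀ : 0 < δ₀) (hδ₁ : 0 < δ₁) (hh : 0 < h) (hh0 : hZeroSq d R δ₀ δ₁ ≤ h ^ 2)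
    (hA𝒫 : 0 ≤ A𝒫') (hA : 1 ≤ A) (hA𝒫A : A𝒫' ≤ A)
    (hsmall : (2 : ℝ) ^ (L ^ d) * (A𝒫' * A ^ (-(1 - (1 + 1 / ((2 * (2 ^ d + 1) + 6 : ℝ) ^ d))⁻¹) : ℝ)) ≤ 1)
    (D : StepData d M) (hDs : D.s = L ^ k) (hDL : D.L = L) (hS : StepKernelBounds (abkmWeightData L N Mord R θbar (schedDelta δ₀ δ₁ N) 𝒞) L k A𝒫' C₂ D.𝒞)
    {x₀ : Fin d → ZMod M} (hB₀ : D.B₀ = blockOf (L ^ k) x₀)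
    (hc₀ : D.c₀ = boxCorner (L ^ k) (starRad R L d k) x₀)
    {K : Finset (Fin d → ZMod M) → ((Fin d → ZMod M) → ℝ) → ℂ} {C : ℝ} (hC : 0 ≤ C)
    (hK : WeakNormLE (abkmNormParams L N Mord R p r₀ h θbar A (schedDelta δ₀ δ₁ N) 𝒞) k K C)
    (hKt : TransInv (L ^ k) K) (hKd : ∀ X, ContDiff ℝ r₀ (K X))
    (hKloc : ∀ X, IsPolymer (L ^ k) X → IsConn X →
      IsGaugeLocal ((abkmNormParams L N Mord R p r₀ h θbar A (schedDelta δ₀ δ₁ N) 𝒞).gauge k X) (K X))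
    {U : Finset (Fin d → ZMod M)} (hU : IsPolymer (L ^ (k + 1)) U) (hUc : IsConn U) :
    TayNormLE ((abkmNormParams L N Mord R p r₀ h θbar A (schedDelta δ₀ δ₁ N) 𝒞).gauge (k + 1) U) r₀
      ((abkmWeightData L N Mord R θbar (schedDelta δ₀ δ₁ N) 𝒞).weight (k + 1) U) (blockPart D K U)
      (C * ((L : ℝ) ^ d * (A𝒫' * abkmContrConst d L R) +
          largePartEps d L A A𝒫' (1 + 1 / ((2 * (2 ^ d + 1) + 6 : ℝ) ^ d)) +
          largePartEps d L A A𝒫' (1 + 1 / ((2 * (2 ^ d + 1) + 6 : ℝ) ^ d))) *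
        (abkmNormParams L N Mord R p r₀ h θbar A (schedDelta δ₀ δ₁ N) 𝒞).aFactor (k + 1) U) := by
  set P := abkmNormParams L N Mord R p r₀ h θbar A (schedDelta δ₀ δ₁ N) 𝒞 with hP
  set W := abkmWeightData L N Mord R θbar (schedDelta δ₀ δ₁ N) 𝒞 with hW
  have hA0 : 0 < A := by linarith
  have hk1 : k + 1 ≤ N + 1 := by omega
  have h1 := weakNormLE_opC_abkm_conn_of_stepKernelBounds hd hLodd hL hM hkN hp hpM hMR hr₀ hB hδ₀ hδ₁ hh hh0 hA𝒫 hA hA𝒫A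
    hsmall D hDs hDL hS hB₀ hc₀ hC hK hKt hKd hKloc U hU hUc
  have h2 := tayNormLE_largePart_fluct_abkm_of_stepKernelBounds (p := p) (r₀ := r₀) hd hLodd hL hM hkN hS hB hh hA𝒫 hA hA𝒫A
    hsmall hC hK hKd hKloc hU hUc.1
  have hbd := contDiff_blockPart_abkm_of_stepKernelBounds hB hLodd hM hA0 D hDs hS hC hK hKd hKloc U
  have hld := contDiff_largePart_abkm_of_stepKernelBounds (p := p) (r₀ := r₀) hB hS hA0 hC hK hKd hKloc U
  have hopCd : ContDiff ℝ r₀ (opC D K U) := by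
    have : opC D K U = fun φ => blockPart D K U φ + largePart D.s D.L (fluct D.𝒞) K U φ := by funext φ; rfl
    rw [this, hDs, hDL]
    exact hbd.add hld
  have heq : blockPart D K U = opC D K U + (-1 : ℝ) • largePart (L ^ k) L (fluct D.𝒞) K U := by
    funext φ
    show blockPart D K U φ = (blockPart D K U φ + largePart D.s D.L (fluct D.𝒞) K U φ) +
      (-1 : ℝ) • largePart (L ^ k) L (fluct D.𝒞) K U φ
    rw [hDs, hDL, neg_one_smul]
    ring
  rw [heq]
  refine ((h1.add (h2.smul hld (-1)) hopCd (hld.const_smul (-1 : ℝ))).mono (le_of_eq ?_)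
    fun φ => (W.weight_pos (k + 1) U φ).le)
  rw [abs_neg, abs_one, one_mul]
  show C * ((L : ℝ) ^ d * (A𝒫' * abkmContrConst d L R) +
      largePartEps d L A A𝒫' (1 + 1 / ((2 * (2 ^ d + 1) + 6 : ℝ) ^ d))) * P.aFactor (k + 1) U +
    C * largePartEps d L A A𝒫' (1 + 1 / ((2 * (2 ^ d + 1) + 6 : ℝ) ^ d)) * P.aFactor (k + 1) U = _
  ring

/-- **Lipschitz (= linear) bound of the block part**: with the data of `tayNormLE_blockPart_abkm_of_stepKernelBounds` for `K`
and `K'` (`‖K‖ ≤ C`, `‖K'‖ ≤ C'`) and `‖K − K'‖_k^{(A)} ≤ C_Δ`, on a connected `(k+1)`-polymer `U`: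
`|blockPart D K U − blockPart D K' U|_{T_{k+1}^{U*}, w_{k+1}^U} ≤ C_Δ(θ₀ + ε)A^{−|U|_{k+1}}`.
[cite: AdamsBuchholzKoteckyMuller2019, Lemma 10.1 / Lemma 10.2] -/
theorem tayNormLE_blockPart_sub_abkm_of_stepKernelBounds {L N Mord R n p r₀ : ℕ} {θbar lam μ δ₁ δ₀ A𝒫 A𝒫' C₂ h A : ℝ}
    {𝒞 : ℕ → (Fin d → ZMod M) → ℝ} (hd : 3 ≤ d) (hLodd : Odd L) (hL : 2 ^ (d + 3) + 16 * R ≤ L)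
    (hM : M = L ^ N) {k : ℕ} (hkN : k + 1 ≤ N) (hp : d / 2 + 2 ≤ p) (hpM : p + d ≤ Mord)
    (hMR : Mord ≤ R) (hr₀ : 3 ≤ r₀)
    (hB : AbkmWeightBounds L N Mord R n θbar lam μ δ₁ δ₀ A𝒫 𝒞
      (abkmWeightData L N Mord R θbar (schedDelta δ₀ δ₁ N) 𝒞))
    (hδ₀ : 0 < δ₀) (hδ₁ : 0 < δ₁) (hh : 0 < h) (hh0 : hZeroSq d R δ₀ δ₁ ≤ h ^ 2)
    (hA𝒫 : 0 ≤ A𝒫') (hA : 1 ≤ A) (hA𝒫A : A𝒫' ≤ A)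
    (hsmall : (2 : ℝ) ^ (L ^ d) * (A𝒫' * A ^ (-(1 - (1 + 1 / ((2 * (2 ^ d + 1) + 6 : ℝ) ^ d))⁻¹) : ℝ)) ≤ 1)
    (D : StepData d M) (hDs : D.s = L ^ k) (hDL : D.L = L) (hS : StepKernelBounds (abkmWeightData L N Mord R θbar (schedDelta δ₀ δ₁ N) 𝒞) L k A𝒫' C₂ D.𝒞)
    {x₀ : Fin d → ZMod M} (hB₀ : D.B₀ = blockOf (L ^ k) x₀)
    (hc₀ : D.c₀ = boxCorner (L ^ k) (starRad R L d k) x₀)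
    {K K' : Finset (Fin d → ZMod M) → ((Fin d → ZMod M) → ℝ) → ℂ} {C C' CΔ : ℝ} (hC : 0 ≤ C) (hC' : 0 ≤ C')
    (hCΔ : 0 ≤ CΔ)
    (hK : WeakNormLE (abkmNormParams L N Mord R p r₀ h θbar A (schedDelta δ₀ δ₁ N) 𝒞) k K C)
    (hK' : WeakNormLE (abkmNormParams L N Mord R p r₀ h θbar A (schedDelta δ₀ δ₁ N) 𝒞) k K' C')
    (hΔ : WeakNormLE (abkmNormParams L N Mord R p r₀ h θbar A (schedDelta δ₀ δ₁ N) 𝒞) k (K - K') CΔ)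
    (hKt : TransInv (L ^ k) K) (hK't : TransInv (L ^ k) K')
    (hKd : ∀ X, ContDiff ℝ r₀ (K X)) (hK'd : ∀ X, ContDiff ℝ r₀ (K' X))
    (hKloc : ∀ X, IsPolymer (L ^ k) X → IsConn X →
      IsGaugeLocal ((abkmNormParams L N Mord R p r₀ h θbar A (schedDelta δ₀ δ₁ N) 𝒞).gauge k X) (K X))
    (hK'loc : ∀ X, IsPolymer (L ^ k) X → IsConn X →
      IsGaugeLocal ((abkmNormParams L N Mord R p r₀ h θbar A (schedDelta δ₀ δ₁ N) 𝒞).gauge k X) (K' X))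
    {U : Finset (Fin d → ZMod M)} (hU : IsPolymer (L ^ (k + 1)) U) (hUc : IsConn U) :
    TayNormLE ((abkmNormParams L N Mord R p r₀ h θbar A (schedDelta δ₀ δ₁ N) 𝒞).gauge (k + 1) U) r₀
      ((abkmWeightData L N Mord R θbar (schedDelta δ₀ δ₁ N) 𝒞).weight (k + 1) U)
      (fun φ => blockPart D K U φ - blockPart D K' U φ)
      (CΔ * ((L : ℝ) ^ d * (A𝒫' * abkmContrConst d L R) +
          largePartEps d L A A𝒫' (1 + 1 / ((2 * (2 ^ d + 1) + 6 : ℝ) ^ d)) +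
          largePartEps d L A A𝒫' (1 + 1 / ((2 * (2 ^ d + 1) + 6 : ℝ) ^ d))) *
        (abkmNormParams L N Mord R p r₀ h θbar A (schedDelta δ₀ δ₁ N) 𝒞).aFactor (k + 1) U) := by
  have hA0 : 0 < A := by linarith
  have hk1 : k + 1 ≤ N + 1 := by omega
  have hr₀2 : 2 ≤ r₀ := by omega
  have hKΔd : ∀ X, ContDiff ℝ r₀ ((K - K') X) := fun X => by
    show ContDiff ℝ r₀ (K X - K' X); exact (hKd X).sub (hK'd X)
  have hKΔloc : ∀ X, IsPolymer (L ^ k) X → IsConn X →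
      IsGaugeLocal ((abkmNormParams L N Mord R p r₀ h θbar A (schedDelta δ₀ δ₁ N) 𝒞).gauge k X) ((K - K') X) :=
    fun X hX hc φ ψ e => by
      show (K X - K' X) φ = (K X - K' X) ψ
      simp only [Pi.sub_apply]
      rw [hKloc X hX hc φ ψ e, hK'loc X hX hc φ ψ e]
  have hKΔt : TransInv (L ^ k) (K - K') := fun a ha X φ => by
    show K _ _ - K' _ _ = K X φ - K' X φ
    rw [hKt a ha X φ, hK't a ha X φ]
  rw [blockPart_sub_abkm_of_stepKernelBounds hB hr₀2 hLodd hM hA0 D hDs hS hB₀ hC hC' hK hK' hKd hK'd hKloc hK'loc U]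
  exact tayNormLE_blockPart_abkm_of_stepKernelBounds hd hLodd hL hM hkN hp hpM hMR hr₀ hB hδ₀ hδ₁ hh hh0 hA𝒫 hA hA𝒫A hsmall
    D hDs hDL hS hB₀ hc₀ hCΔ hΔ hKΔt hKΔd hKΔloc hU hUc

end Literature.MathematicalPhysics.StatisticalMechanics.GradientRG

end
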